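import Literature.Computability.AlgebraicComplexity.LRCanonicalWeights
import HarnessLib

/-!
# Two-sided-torus lower bound for `per_m` — I: torus weights of the canonical subspaces for
# GENERAL multipliers

Support file for crux `ProjectionStability.OptStep` (stmt-ValiantsHypothesis-17835), line `Sketch`,
stub K2 `stub_twoSidedTorus_lower` ("every two-sided-torus-equivariant affine determinantal
representation of `per_m`, `m ≥ 3`, has size `≥ 2^m − 1`").

The tree's proof of Landsberg–Ressayre Thm 2.8 (`LRTorusWeights.lean`, `LRCanonicalWeights.lean`,
`LRWeightCount.lean`) packages the pencil `Ã = Λ + Σ x_{kj} A_{kj}`, ONE lifted torus element and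
its weights in a `TorusData`, whose multipliers are distinct PRIMES `p_k ∈ ℕ` (weights
`wt u = γ₀ ∏ p_k^{u_k}`, injective by unique factorisation).  K2 runs the same machinery on the
restricted pencils `Λ + Σ_k y_k A_{k,π k}` of a two-sided-torus-equivariant representation, whose
multipliers `p_k q_{π k}` are NOT prime.  This file re-proves the weight calculus of
`LRTorusWeights.lean` (namespace `TorusData`) and all of `LRCanonicalWeights.lean` for an exact lift
`L : LRPencil.Lift Λ A 1 r` of a torus element with ARBITRARY multipliers `r : Fin m → ℂ` and an
abstract INJECTIVE weight function `wt : (Fin m → ℕ) → ℂ` with `wt (u + e_k) = r_k · wt u` and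
`ker Λ ⊆ F (wt 0)`; the proofs are those of the tree files, verbatim up to this unbundling
(no new definition is introduced: `E β`, `F γ`, `Z S' u` of the tree are written out).

Contents: weight shifts (`map_Λ_F_le`, `map_A_F_wt_le`, `map_A_ker_le`, `ker_inf_F_wt_eq_bot`),
the comparison spaces and one chain step (`map_comap_Z_le`), weights of `Λ⁻¹ P`
(`comap_le_iSup_sup_ker`), weights of `𝒫_S` (`canon_le_iSup_Z`, `canon_inf_wt_le`,
`canon_le_grid`, `canon_le_iSup_inf`) and descent (`exists_pred_of_canon_inf_wt_ne_bot`).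

## References
* J. M. Landsberg, N. Ressayre, arXiv:1508.05788, §6 (method).
* Tree: `Literature/Computability/AlgebraicComplexity/LRTorusWeights.lean`, `LRCanonicalWeights.lean`.
-/

noncomputable section

set_option linter.dupNamespace false

namespace Summit.ValiantsHypothesis.ValiantsHypothesis.Theorems.ProjectionStabilityOptStep.GenTorus

open Submodule Module.End Finset
open Literature.Computability.AlgebraicComplexity LRPencil

variable {V : Type*} [AddCommGroup V] [Module ℂ V] {m : ℕ}
variable {Λ : Module.End ℂ V} {A : Fin m → Fin m → Module.End ℂ V} {r : Fin m → ℂ}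
variable (L : Lift Λ A 1 r) (wt : (Fin m → ℕ) → ℂ)


/-! ### Weight shifts -/

/-- `Λ (F γ) ⊆ E γ`. [cite: LandsbergRessayre2017, §6] -/
theorem map_Λ_F_le (γ : ℂ) : ((maxGenEigenspace (L.C : V →ₗ[ℂ] V)) γ).map Λ ≤ (maxGenEigenspace (L.B : V →ₗ[ℂ] V)) γ := by
  have h : (L.B : V →ₗ[ℂ] V) ∘ₗ Λ = (1 : ℂ) • (Λ ∘ₗ (L.C : V →ₗ[ℂ] V)) := by
    rw [one_smul]; exact L.comp_Λ
  simpa using map_maxGenEigenspace_le_of_comp_eq_smul _ _ Λ 1 h γ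

/-- `A_{kj} (F γ) ⊆ E (r_k γ)`. [cite: LandsbergRessayre2017, §6] -/
theorem map_A_F_le (k j : Fin m) (γ : ℂ) : ((maxGenEigenspace (L.C : V →ₗ[ℂ] V)) γ).map (A k j) ≤ (maxGenEigenspace (L.B : V →ₗ[ℂ] V)) (r k * γ) := by
  have h := L.comp_A k j
  rw [Equiv.Perm.one_apply] at h
  exact map_maxGenEigenspace_le_of_comp_eq_smul _ _ (A k j) _ h γ

/-- `A_{kj} (F (wt u)) ⊆ E (wt (u + e_k))`. [cite: LandsbergRessayre2017, §6] -/
theorem map_A_F_wt_le (hstep : ∀ (u : Fin m → ℕ) (k : Fin m), wt (u + Pi.single k 1) = r k * wt u)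
    (k j : Fin m) (u : Fin m → ℕ) :
    ((maxGenEigenspace (L.C : V →ₗ[ℂ] V)) (wt u)).map (A k j) ≤ (maxGenEigenspace (L.B : V →ₗ[ℂ] V)) (wt (u + Pi.single k 1)) := by
  rw [hstep]; exact map_A_F_le L k j _

/-- `A_{kj} (ker Λ) ⊆ E (wt e_k)`. [cite: LandsbergRessayre2017, §6] -/
theorem map_A_ker_le (hstep : ∀ (u : Fin m → ℕ) (k : Fin m), wt (u + Pi.single k 1) = r k * wt u)
    (hker : LinearMap.ker Λ ≤ (maxGenEigenspace (L.C : V →ₗ[ℂ] V)) (wt 0)) (k j : Fin m) :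
    (LinearMap.ker Λ).map (A k j) ≤ (maxGenEigenspace (L.B : V →ₗ[ℂ] V)) (wt (0 + Pi.single k 1)) :=
  (Submodule.map_mono hker).trans (map_A_F_wt_le L wt hstep k j 0)

/-- `ker Λ` meets no `F (wt u)` with `u ≠ 0`. [folklore] -/
theorem ker_inf_F_wt_eq_bot (hinj : Function.Injective wt) (hker : LinearMap.ker Λ ≤ (maxGenEigenspace (L.C : V →ₗ[ℂ] V)) (wt 0))
    {u : Fin m → ℕ} (hu : u ≠ 0) : LinearMap.ker Λ ⊓ (maxGenEigenspace (L.C : V →ₗ[ℂ] V)) (wt u) = ⊥ := by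
  have hne : wt 0 ≠ wt u := fun h => hu (hinj h).symm
  rw [eq_bot_iff]
  exact (le_inf (inf_le_left.trans hker) inf_le_right).trans
    (Module.End.disjoint_genEigenspace (L.C : V →ₗ[ℂ] V) hne ⊤ ⊤).le_bot

/-- `E β` is `B`-stable. [folklore] -/
theorem map_E_le (β : ℂ) : ((maxGenEigenspace (L.B : V →ₗ[ℂ] V)) β).map (L.B : V →ₗ[ℂ] V) ≤ (maxGenEigenspace (L.B : V →ₗ[ℂ] V)) β :=
  Submodule.map_le_iff_le_comap.2 fun _ hv =>
    Module.End.mapsTo_maxGenEigenspace_of_comm (Commute.refl (L.B : V →ₗ[ℂ] V)) β hv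

/-! ### The comparison spaces `Z S' u` -/

/-- `Z S' u ⊆ E (wt u)`. [folklore] -/
theorem Z_le_E (S' : Finset (Fin m)) (u : Fin m → ℕ) : (if supp (u) ⊆ S' then canon Λ A S' ⊓ (maxGenEigenspace (L.B : V →ₗ[ℂ] V)) (wt (u)) else (maxGenEigenspace (L.B : V →ₗ[ℂ] V)) (wt (u))) ≤ (maxGenEigenspace (L.B : V →ₗ[ℂ] V)) (wt u) := by
  split_ifs
  · exact inf_le_right
  · exact le_rfl

/-- `Z S' u` is `B`-stable. [folklore] -/
theorem map_Z_le (S' : Finset (Fin m)) (u : Fin m → ℕ) : ((if supp (u) ⊆ S' then canon Λ A S' ⊓ (maxGenEigenspace (L.B : V →ₗ[ℂ] V)) (wt (u)) else (maxGenEigenspace (L.B : V →ₗ[ℂ] V)) (wt (u)))).map (L.B : V →ₗ[ℂ] V) ≤ (if supp (u) ⊆ S' then canon Λ A S' ⊓ (maxGenEigenspace (L.B : V →ₗ[ℂ] V)) (wt (u)) else (maxGenEigenspace (L.B : V →ₗ[ℂ] V)) (wt (u))) := by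
  split_ifs
  · exact (Submodule.map_inf_le _).trans (inf_le_inf (L.map_canon_eq_self S').le (map_E_le L _))
  · exact map_E_le L _

/-- One step of the chain inside the comparison space:
`A_{kj} (Λ⁻¹ (Z S' u) ∩ F (wt u)) ⊆ Z S' (u + e_k)`. [folklore] -/
theorem map_comap_Z_le (hstep : ∀ (u : Fin m → ℕ) (k : Fin m), wt (u + Pi.single k 1) = r k * wt u)
    (S' : Finset (Fin m)) (k j : Fin m) (u : Fin m → ℕ) :
    (((if supp (u) ⊆ S' then canon Λ A S' ⊓ (maxGenEigenspace (L.B : V →ₗ[ℂ] V)) (wt (u)) else (maxGenEigenspace (L.B : V →ₗ[ℂ] V)) (wt (u)))).comap Λ ⊓ (maxGenEigenspace (L.C : V →ₗ[ℂ] V)) (wt u)).map (A k j) ≤ (if supp (u + Pi.single k 1) ⊆ S' then canon Λ A S' ⊓ (maxGenEigenspace (L.B : V →ₗ[ℂ] V)) (wt (u + Pi.single k 1)) else (maxGenEigenspace (L.B : V →ₗ[ℂ] V)) (wt (u + Pi.single k 1))) := by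
  have hE : (((if supp (u) ⊆ S' then canon Λ A S' ⊓ (maxGenEigenspace (L.B : V →ₗ[ℂ] V)) (wt (u)) else (maxGenEigenspace (L.B : V →ₗ[ℂ] V)) (wt (u)))).comap Λ ⊓ (maxGenEigenspace (L.C : V →ₗ[ℂ] V)) (wt u)).map (A k j) ≤ (maxGenEigenspace (L.B : V →ₗ[ℂ] V)) (wt (u + Pi.single k 1)) :=
    (Submodule.map_mono inf_le_right).trans (map_A_F_wt_le L wt hstep k j u)
  by_cases h' : supp (u + Pi.single k 1) ⊆ S'
  · have hu : supp u ⊆ S' := by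
      rw [supp_add_single] at h'; exact (subset_insert _ _).trans h'
    have hkS' : k ∈ S' := by rw [supp_add_single] at h'; exact h' (mem_insert_self _ _)
    rw [if_pos h']
    refine le_inf ?_ hE
    calc (((if supp (u) ⊆ S' then canon Λ A S' ⊓ (maxGenEigenspace (L.B : V →ₗ[ℂ] V)) (wt (u)) else (maxGenEigenspace (L.B : V →ₗ[ℂ] V)) (wt (u)))).comap Λ ⊓ (maxGenEigenspace (L.C : V →ₗ[ℂ] V)) (wt u)).map (A k j)
        ≤ ((canon Λ A S').comap Λ).map (A k j) := by
          refine Submodule.map_mono (inf_le_left.trans (Submodule.comap_mono ?_))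
          rw [if_pos hu]; exact inf_le_left
      _ ≤ canon Λ A S' := isClosedUnder_canon S' k hkS' j
  · rw [if_neg h']
    exact hE

/-- `A_{kj} (ker Λ) ⊆ Z S' e_k`. [folklore] -/
theorem map_ker_le_Z (hstep : ∀ (u : Fin m → ℕ) (k : Fin m), wt (u + Pi.single k 1) = r k * wt u)
    (hker : LinearMap.ker Λ ≤ (maxGenEigenspace (L.C : V →ₗ[ℂ] V)) (wt 0)) (S' : Finset (Fin m)) (k j : Fin m) :
    (LinearMap.ker Λ).map (A k j) ≤ (if supp (0 + Pi.single k 1) ⊆ S' then canon Λ A S' ⊓ (maxGenEigenspace (L.B : V →ₗ[ℂ] V)) (wt (0 + Pi.single k 1)) else (maxGenEigenspace (L.B : V →ₗ[ℂ] V)) (wt (0 + Pi.single k 1))) := by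
  split_ifs with h
  · have hk : k ∈ S' := by
      rw [supp_add_single] at h; exact h (mem_insert_self _ _)
    exact le_inf (map_ker_le_canon hk j) (map_A_ker_le L wt hstep hker k j)
  · exact map_A_ker_le L wt hstep hker k j

/-! ### Weights of `Λ⁻¹ P` -/

variable [FiniteDimensional ℂ V]

/-- For a `B`-stable `P`: `Λ⁻¹ P ⊆ Σ_γ (Λ⁻¹ (P ∩ E γ) ∩ F γ)`. [cite: LandsbergRessayre2017, §6] -/
theorem comap_le_iSup {P : Submodule ℂ V} (hP : P.map (L.B : V →ₗ[ℂ] V) ≤ P) :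
    P.comap Λ ≤ ⨆ γ, (P ⊓ (maxGenEigenspace (L.B : V →ₗ[ℂ] V)) γ).comap Λ ⊓ (maxGenEigenspace (L.C : V →ₗ[ℂ] V)) γ := by
  have hW : (P.comap Λ).map (L.C : V →ₗ[ℂ] V) ≤ P.comap Λ := by
    rw [← L.comap_map_eq]; exact Submodule.comap_mono hP
  calc P.comap Λ = ⨆ γ, P.comap Λ ⊓ (maxGenEigenspace (L.C : V →ₗ[ℂ] V)) γ := eq_iSup_inf_maxGen _ hW
    _ ≤ ⨆ γ, (P ⊓ (maxGenEigenspace (L.B : V →ₗ[ℂ] V)) γ).comap Λ ⊓ (maxGenEigenspace (L.C : V →ₗ[ℂ] V)) γ := iSup_mono fun γ => ?_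
  rintro w ⟨hw, hwγ⟩
  refine ⟨?_, hwγ⟩
  simp only [SetLike.mem_coe, Submodule.mem_comap, Submodule.mem_inf] at hw ⊢
  exact ⟨hw, map_Λ_F_le L γ (Submodule.mem_map_of_mem hwγ)⟩

/-- The same when the weights of `P` lie in a family `w`: `Λ⁻¹ P ⊆ Σ_i (Λ⁻¹ (P ∩ E (w i)) ∩ F (w i)) + ker Λ`.
[cite: LandsbergRessayre2017, §6] -/
theorem comap_le_iSup_sup_ker {ι : Type*} (w : ι → ℂ) {P : Submodule ℂ V}
    (hP : P.map (L.B : V →ₗ[ℂ] V) ≤ P) (hPw : P ≤ ⨆ i, (maxGenEigenspace (L.B : V →ₗ[ℂ] V)) (w i)) :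
    P.comap Λ ≤ (⨆ i, (P ⊓ (maxGenEigenspace (L.B : V →ₗ[ℂ] V)) (w i)).comap Λ ⊓ (maxGenEigenspace (L.C : V →ₗ[ℂ] V)) (w i)) ⊔ LinearMap.ker Λ := by
  refine (comap_le_iSup L hP).trans (iSup_le fun γ => ?_)
  by_cases h : ∃ i, w i = γ
  · obtain ⟨i, rfl⟩ := h
    exact (le_iSup (fun i => (P ⊓ (maxGenEigenspace (L.B : V →ₗ[ℂ] V)) (w i)).comap Λ ⊓ (maxGenEigenspace (L.C : V →ₗ[ℂ] V)) (w i)) i).trans le_sup_left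
  · push Not at h
    have h0 : P ⊓ (maxGenEigenspace (L.B : V →ₗ[ℂ] V)) γ = ⊥ := by
      rw [eq_bot_iff]
      calc P ⊓ (maxGenEigenspace (L.B : V →ₗ[ℂ] V)) γ ≤ (⨆ i, (maxGenEigenspace (L.B : V →ₗ[ℂ] V)) (w i)) ⊓ (maxGenEigenspace (L.B : V →ₗ[ℂ] V)) γ := inf_le_inf_right _ hPw
        _ = ⊥ := iSup_maxGen_inf_eq_bot _ w h
    rw [h0, Submodule.comap_bot]
    exact inf_le_left.trans le_sup_right

/-! ### Weights of the canonical subspaces -/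

/-- The comparison space `Σ_{u ∈ U S} Z S' u` is closed under the rows in `S`, hence contains `𝒫_S`.
[folklore] -/
theorem canon_le_iSup_Z (hinj : Function.Injective wt)
    (hstep : ∀ (u : Fin m → ℕ) (k : Fin m), wt (u + Pi.single k 1) = r k * wt u)
    (hker : LinearMap.ker Λ ≤ (maxGenEigenspace (L.C : V →ₗ[ℂ] V)) (wt 0)) (S S' : Finset (Fin m)) :
    canon Λ A S ≤ ⨆ u : U S, (if supp ((u : Fin m → ℕ)) ⊆ S' then canon Λ A S' ⊓ (maxGenEigenspace (L.B : V →ₗ[ℂ] V)) (wt ((u : Fin m → ℕ))) else (maxGenEigenspace (L.B : V →ₗ[ℂ] V)) (wt ((u : Fin m → ℕ)))) := by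
  set G : Submodule ℂ V := ⨆ u : U S, (if supp ((u : Fin m → ℕ)) ⊆ S' then canon Λ A S' ⊓ (maxGenEigenspace (L.B : V →ₗ[ℂ] V)) (wt ((u : Fin m → ℕ))) else (maxGenEigenspace (L.B : V →ₗ[ℂ] V)) (wt ((u : Fin m → ℕ)))) with hG
  have hGst : G.map (L.B : V →ₗ[ℂ] V) ≤ G := by
    rw [hG, Submodule.map_iSup]
    exact iSup_mono fun u => map_Z_le L wt S' u
  have hGw : G ≤ ⨆ u : U S, (maxGenEigenspace (L.B : V →ₗ[ℂ] V)) (wt u) := iSup_mono fun u => Z_le_E L wt S' u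
  have hpiece : ∀ u : U S, G ⊓ (maxGenEigenspace (L.B : V →ₗ[ℂ] V)) (wt u) ≤ (if supp ((u : Fin m → ℕ)) ⊆ S' then canon Λ A S' ⊓ (maxGenEigenspace (L.B : V →ₗ[ℂ] V)) (wt ((u : Fin m → ℕ))) else (maxGenEigenspace (L.B : V →ₗ[ℂ] V)) (wt ((u : Fin m → ℕ)))) := fun u => by
    refine (iSup_inf_maxGen_le _ (fun u : U S => (if supp ((u : Fin m → ℕ)) ⊆ S' then canon Λ A S' ⊓ (maxGenEigenspace (L.B : V →ₗ[ℂ] V)) (wt ((u : Fin m → ℕ))) else (maxGenEigenspace (L.B : V →ₗ[ℂ] V)) (wt ((u : Fin m → ℕ))))) (fun u => wt u)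
      (fun u => Z_le_E L wt S' u) (wt u)).trans (iSup₂_le fun u' hu' => ?_)
    rw [Subtype.ext (hinj hu')]
  apply canon_le
  intro k hk j
  refine (Submodule.map_mono (comap_le_iSup_sup_ker L (fun u : U S => wt u) hGst hGw)).trans ?_
  rw [Submodule.map_sup, Submodule.map_iSup]
  refine sup_le (iSup_le fun u => ?_) ?_
  · calc (((G ⊓ (maxGenEigenspace (L.B : V →ₗ[ℂ] V)) (wt u)).comap Λ ⊓ (maxGenEigenspace (L.C : V →ₗ[ℂ] V)) (wt u)).map (A k j))
        ≤ ((((if supp ((u : Fin m → ℕ)) ⊆ S' then canon Λ A S' ⊓ (maxGenEigenspace (L.B : V →ₗ[ℂ] V)) (wt ((u : Fin m → ℕ))) else (maxGenEigenspace (L.B : V →ₗ[ℂ] V)) (wt ((u : Fin m → ℕ))))).comap Λ ⊓ (maxGenEigenspace (L.C : V →ₗ[ℂ] V)) (wt u)).map (A k j)) :=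
          Submodule.map_mono (inf_le_inf_right _ (Submodule.comap_mono (hpiece u)))
      _ ≤ (if supp ((u : Fin m → ℕ) + Pi.single k 1) ⊆ S' then canon Λ A S' ⊓ (maxGenEigenspace (L.B : V →ₗ[ℂ] V)) (wt ((u : Fin m → ℕ) + Pi.single k 1)) else (maxGenEigenspace (L.B : V →ₗ[ℂ] V)) (wt ((u : Fin m → ℕ) + Pi.single k 1))) := map_comap_Z_le L wt hstep S' k j u
      _ ≤ G := le_iSup (fun u : U S => (if supp ((u : Fin m → ℕ)) ⊆ S' then canon Λ A S' ⊓ (maxGenEigenspace (L.B : V →ₗ[ℂ] V)) (wt ((u : Fin m → ℕ))) else (maxGenEigenspace (L.B : V →ₗ[ℂ] V)) (wt ((u : Fin m → ℕ))))) ⟨(u : Fin m → ℕ) + Pi.single k 1,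
          add_single_mem_U u.2.2 hk⟩
  · calc (LinearMap.ker Λ).map (A k j) ≤ (if supp ((0 : Fin m → ℕ) + Pi.single k 1) ⊆ S' then canon Λ A S' ⊓ (maxGenEigenspace (L.B : V →ₗ[ℂ] V)) (wt ((0 : Fin m → ℕ) + Pi.single k 1)) else (maxGenEigenspace (L.B : V →ₗ[ℂ] V)) (wt ((0 : Fin m → ℕ) + Pi.single k 1))) :=
          map_ker_le_Z L wt hstep hker S' k j
      _ ≤ G := le_iSup (fun u : U S => (if supp ((u : Fin m → ℕ)) ⊆ S' then canon Λ A S' ⊓ (maxGenEigenspace (L.B : V →ₗ[ℂ] V)) (wt ((u : Fin m → ℕ))) else (maxGenEigenspace (L.B : V →ₗ[ℂ] V)) (wt ((u : Fin m → ℕ))))) ⟨_, single_mem_U hk⟩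

/-- **Weights of `𝒫_S` refine along supports**: for `u ≠ 0` with `supp u ⊆ S'`, the weight-`wt u`
part of `𝒫_S` lies in `𝒫_{S'}`. [cite: LandsbergRessayre2017, §6] -/
theorem canon_inf_wt_le (hinj : Function.Injective wt)
    (hstep : ∀ (u : Fin m → ℕ) (k : Fin m), wt (u + Pi.single k 1) = r k * wt u)
    (hker : LinearMap.ker Λ ≤ (maxGenEigenspace (L.C : V →ₗ[ℂ] V)) (wt 0)) {S S' : Finset (Fin m)} {u : Fin m → ℕ} (hU : u ∈ U S)
    (hu : supp u ⊆ S') : canon Λ A S ⊓ (maxGenEigenspace (L.B : V →ₗ[ℂ] V)) (wt u) ≤ canon Λ A S' ⊓ (maxGenEigenspace (L.B : V →ₗ[ℂ] V)) (wt u) :=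
  calc canon Λ A S ⊓ (maxGenEigenspace (L.B : V →ₗ[ℂ] V)) (wt u) ≤ (⨆ u : U S, (if supp ((u : Fin m → ℕ)) ⊆ S' then canon Λ A S' ⊓ (maxGenEigenspace (L.B : V →ₗ[ℂ] V)) (wt ((u : Fin m → ℕ))) else (maxGenEigenspace (L.B : V →ₗ[ℂ] V)) (wt ((u : Fin m → ℕ))))) ⊓ (maxGenEigenspace (L.B : V →ₗ[ℂ] V)) (wt u) :=
        inf_le_inf_right _ (canon_le_iSup_Z L wt hinj hstep hker S S')
    _ ≤ ⨆ (u' : U S) (_ : wt u' = wt u), (if supp ((u' : Fin m → ℕ)) ⊆ S' then canon Λ A S' ⊓ (maxGenEigenspace (L.B : V →ₗ[ℂ] V)) (wt ((u' : Fin m → ℕ))) else (maxGenEigenspace (L.B : V →ₗ[ℂ] V)) (wt ((u' : Fin m → ℕ)))) :=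
        iSup_inf_maxGen_le _ _ (fun u' : U S => wt u') (fun u' => Z_le_E L wt S' u') _
    _ ≤ (if supp (u) ⊆ S' then canon Λ A S' ⊓ (maxGenEigenspace (L.B : V →ₗ[ℂ] V)) (wt (u)) else (maxGenEigenspace (L.B : V →ₗ[ℂ] V)) (wt (u))) := iSup₂_le fun u' hu' => by
        rw [show u' = ⟨u, hU⟩ from Subtype.ext (hinj hu')]
    _ = canon Λ A S' ⊓ (maxGenEigenspace (L.B : V →ₗ[ℂ] V)) (wt u) := if_pos hu

/-- In particular the weight-`wt u` part of `𝒫_S` lies in `𝒫_{supp u}`. [cite: LandsbergRessayre2017, §6] -/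
theorem canon_inf_wt_le_canon_supp (hinj : Function.Injective wt)
    (hstep : ∀ (u : Fin m → ℕ) (k : Fin m), wt (u + Pi.single k 1) = r k * wt u)
    (hker : LinearMap.ker Λ ≤ (maxGenEigenspace (L.C : V →ₗ[ℂ] V)) (wt 0)) {S : Finset (Fin m)} {u : Fin m → ℕ} (hu : u ∈ U S) :
    canon Λ A S ⊓ (maxGenEigenspace (L.B : V →ₗ[ℂ] V)) (wt u) ≤ canon Λ A (supp u) :=
  (canon_inf_wt_le L wt hinj hstep hker hu subset_rfl).trans inf_le_left

/-- **The weights of `𝒫_S`** are among the `wt u`, `0 ≠ u`, `supp u ⊆ S`. [cite: LandsbergRessayre2017, §6] -/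
theorem canon_le_grid (hinj : Function.Injective wt)
    (hstep : ∀ (u : Fin m → ℕ) (k : Fin m), wt (u + Pi.single k 1) = r k * wt u)
    (hker : LinearMap.ker Λ ≤ (maxGenEigenspace (L.C : V →ₗ[ℂ] V)) (wt 0)) (S : Finset (Fin m)) :
    canon Λ A S ≤ ⨆ u : U S, (maxGenEigenspace (L.B : V →ₗ[ℂ] V)) (wt u) :=
  (canon_le_iSup_Z L wt hinj hstep hker S ∅).trans (iSup_mono fun u => Z_le_E L wt ∅ u)

/-- Hence `𝒫_S` is the sum of its pieces of weight `wt u`, `u ∈ U S`. [cite: LandsbergRessayre2017, §6] -/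
theorem canon_le_iSup_inf (hinj : Function.Injective wt)
    (hstep : ∀ (u : Fin m → ℕ) (k : Fin m), wt (u + Pi.single k 1) = r k * wt u)
    (hker : LinearMap.ker Λ ≤ (maxGenEigenspace (L.C : V →ₗ[ℂ] V)) (wt 0)) (S : Finset (Fin m)) :
    canon Λ A S ≤ ⨆ u : U S, canon Λ A S ⊓ (maxGenEigenspace (L.B : V →ₗ[ℂ] V)) (wt u) := by
  have hst : (canon Λ A S).map (L.B : V →ₗ[ℂ] V) ≤ canon Λ A S := (L.map_canon_eq_self S).le
  conv_lhs => rw [eq_iSup_inf_maxGen _ hst]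
  refine iSup_le fun β => ?_
  by_cases h : ∃ u : U S, wt u = β
  · obtain ⟨u, rfl⟩ := h
    exact le_iSup (fun u : U S => canon Λ A S ⊓ (maxGenEigenspace (L.B : V →ₗ[ℂ] V)) (wt u)) u
  · push Not at h
    have : canon Λ A S ⊓ (maxGenEigenspace (L.B : V →ₗ[ℂ] V)) β = ⊥ := by
      rw [eq_bot_iff]
      calc canon Λ A S ⊓ (maxGenEigenspace (L.B : V →ₗ[ℂ] V)) β ≤ (⨆ u : U S, (maxGenEigenspace (L.B : V →ₗ[ℂ] V)) (wt u)) ⊓ (maxGenEigenspace (L.B : V →ₗ[ℂ] V)) β :=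
            inf_le_inf_right _ (canon_le_grid L wt hinj hstep hker S)
        _ = ⊥ := iSup_maxGen_inf_eq_bot _ _ h
    rw [this]; exact bot_le

/-! ### Descent -/

/-- **Descent**: if `𝒫_S` has weight `wt u` with `u ≠ e_k` for all `k`, then `u = u' + e_k` with
`k ∈ S`, `u' ∈ U S`, and `wt u'` is a weight of `𝒫_S ∩ range Λ`. [cite: LandsbergRessayre2017, §6] -/
theorem exists_pred_of_canon_inf_wt_ne_bot (hinj : Function.Injective wt)
    (hstep : ∀ (u : Fin m → ℕ) (k : Fin m), wt (u + Pi.single k 1) = r k * wt u)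
    (hker : LinearMap.ker Λ ≤ (maxGenEigenspace (L.C : V →ₗ[ℂ] V)) (wt 0)) {S : Finset (Fin m)} {u : Fin m → ℕ}
    (hu1 : ∀ k, u ≠ 0 + Pi.single k 1) (hne : canon Λ A S ⊓ (maxGenEigenspace (L.B : V →ₗ[ℂ] V)) (wt u) ≠ ⊥) :
    ∃ k ∈ S, ∃ u' ∈ U S, u = u' + Pi.single k 1 ∧
      canon Λ A S ⊓ (maxGenEigenspace (L.B : V →ₗ[ℂ] V)) (wt u') ⊓ LinearMap.range Λ ≠ ⊥ := by
  classical
  set P := canon Λ A S with hP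
  have hst : P.map (L.B : V →ₗ[ℂ] V) ≤ P := (L.map_canon_eq_self S).le
  -- the candidate pieces, indexed by `(k, j, u')` (`u' = none` encodes `ker Λ`)
  let Y : Fin m × Fin m × Option (U S) → Submodule ℂ V := fun i =>
    if i.1 ∈ S then
      (match i.2.2 with
        | some u' => ((P ⊓ (maxGenEigenspace (L.B : V →ₗ[ℂ] V)) (wt u')).comap Λ ⊓ (maxGenEigenspace (L.C : V →ₗ[ℂ] V)) (wt u')).map (A i.1 i.2.1)
        | none => (LinearMap.ker Λ).map (A i.1 i.2.1))
    else ⊥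
  let w : Fin m × Fin m × Option (U S) → ℂ := fun i =>
    match i.2.2 with
    | some u' => wt (u'.1 + Pi.single i.1 1)
    | none => wt (0 + Pi.single i.1 1)
  have hY : ∀ i, Y i ≤ (maxGenEigenspace (L.B : V →ₗ[ℂ] V)) (w i) := by
    rintro ⟨k, j, _ | u'⟩
    · by_cases hk : k ∈ S
      · simp only [Y, w, if_pos hk]; exact map_A_ker_le L wt hstep hker k j
      · simp only [Y, if_neg hk]; exact bot_le
    · by_cases hk : k ∈ S
      · simp only [Y, w, if_pos hk]
        exact (Submodule.map_mono inf_le_right).trans (map_A_F_wt_le L wt hstep k j u')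
      · simp only [Y, if_neg hk]; exact bot_le
  have hPY : P ≤ ⨆ i, Y i := by
    refine (canon_le_step S).trans (iSup₂_le fun k hk => iSup_le fun j => ?_)
    refine (Submodule.map_mono (comap_le_iSup_sup_ker L (fun u : U S => wt u) hst
      (canon_le_grid L wt hinj hstep hker S))).trans ?_
    rw [Submodule.map_sup, Submodule.map_iSup]
    refine sup_le (iSup_le fun u' => ?_) ?_
    · refine le_trans (le_of_eq ?_) (le_iSup Y (k, j, some u'))
      simp only [Y, if_pos hk]
    · refine le_trans (le_of_eq ?_) (le_iSup Y (k, j, none))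
      simp only [Y, if_pos hk]
  have hex : P ⊓ (maxGenEigenspace (L.B : V →ₗ[ℂ] V)) (wt u) ≤ ⨆ (i) (_ : w i = wt u), Y i :=
    (inf_le_inf_right _ hPY).trans (iSup_inf_maxGen_le _ Y w hY _)
  -- some candidate piece of weight `wt u` is non-zero
  obtain ⟨i, hwi, hYi⟩ : ∃ i, w i = wt u ∧ Y i ≠ ⊥ := by
    by_contra hall
    push Not at hall
    apply hne
    rw [eq_bot_iff]
    exact hex.trans (iSup₂_le fun i hi => (hall i hi).le)
  rcases i with ⟨k, j, _ | u'⟩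
  · exact (hu1 k (hinj hwi).symm).elim
  · have hk : k ∈ S := by
      by_contra hk
      exact hYi (by simp only [Y, if_neg hk])
    have hYi' : ((P ⊓ (maxGenEigenspace (L.B : V →ₗ[ℂ] V)) (wt u')).comap Λ ⊓ (maxGenEigenspace (L.C : V →ₗ[ℂ] V)) (wt u')).map (A k j) ≠ ⊥ := by
      intro h; apply hYi; simp only [Y, if_pos hk]; exact h
    refine ⟨k, hk, u', u'.2, (hinj hwi).symm, ?_⟩
    -- a non-zero vector of `Λ⁻¹(P ∩ E (wt u')) ∩ F (wt u')` is not in `ker Λ`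
    intro hbot
    apply hYi'
    rw [eq_bot_iff]
    rintro _ ⟨x, ⟨hx1, hx2⟩, rfl⟩
    rw [Submodule.mem_bot]
    have hΛx : Λ x ∈ P ⊓ (maxGenEigenspace (L.B : V →ₗ[ℂ] V)) (wt u') ⊓ LinearMap.range Λ :=
      ⟨hx1, LinearMap.mem_range_self _ _⟩
    rw [hbot, Submodule.mem_bot] at hΛx
    have hxK : x ∈ LinearMap.ker Λ ⊓ (maxGenEigenspace (L.C : V →ₗ[ℂ] V)) (wt u') := ⟨hΛx, hx2⟩
    rw [ker_inf_F_wt_eq_bot L wt hinj hker u'.2.1, Submodule.mem_bot] at hxK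
    rw [hxK, map_zero]

end Summit.ValiantsHypothesis.ValiantsHypothesis.Theorems.ProjectionStabilityOptStep.GenTorus

namespace Summit.ValiantsHypothesis.ValiantsHypothesis.Theorems.ProjectionStabilityOptStep.GenTorus

open Literature.Computability.AlgebraicComplexity

/-! ### Export (registered helper stub of stmt-ValiantsHypothesis-17835) -/

/-- **Descent, closed form** (all data explicit; this is the registered helper stub
`stub_genTorus_descent` of the crux item, = `exists_pred_of_canon_inf_wt_ne_bot`). [cite: LandsbergRessayre2017, §6] -/
theorem stub_genTorus_descent : ∀ {V : Type} [AddCommGroup V] [Module ℂ V] [FiniteDimensional ℂ V] {m : ℕ} {Λ : Module.End ℂ V} {A : Fin m → Fin m → Module.End ℂ V} {r : Fin m → ℂ} (L : LRPencil.Lift Λ A 1 r) (wt : (Fin m → ℕ) → ℂ), Function.Injective wt → (∀ (u : Fin m → ℕ) (k : Fin m), wt (u + Pi.single k 1) = r k * wt u) → LinearMap.ker Λ ≤ Module.End.maxGenEigenspace (L.C : V →ₗ[ℂ] V) (wt 0) → ∀ (S : Finset (Fin m)) (u : Fin m → ℕ), (∀ k, u ≠ 0 + Pi.single k 1) → LRPencil.canon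 Λ A S ⊓ Module.End.maxGenEigenspace (L.B : V →ₗ[ℂ] V) (wt u) ≠ ⊥ → ∃ k ∈ S, ∃ u' ∈ LRPencil.U S, u = u' + Pi.single k 1 ∧ LRPencil.canon Λ A S ⊓ Module.End.maxGenEigenspace (L.B : V →ₗ[ℂ] V) (wt u') ⊓ LinearMap.range Λ ≠ ⊥ :=
  fun L wt hinj hstep hker _ _ hu1 hne => exists_pred_of_canon_inf_wt_ne_bot L wt hinj hstep hker hu1 hne

end Summit.ValiantsHypothesis.ValiantsHypothesis.Theorems.ProjectionStabilityOptStep.GenTorus
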